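import Summits.BirchSwinnertonDyer.Rank1Residual.SecondDescent.EmptyRecordsThree01
import Literature.NumberTheory.EllipticCurves.NonEisensteinPrimeOfSurjective
import HarnessLib

/-!
# B-1 second-3-descent `EMPTY` record SHAPES for a literal model with SURJECTIVE `ρ̄_{E,3}`, analytic rank `≤ 1` (the rank-ONE `#Ш_an = 9·u` rows of O3 = X8 r1 and O4@3 = X7 r1) (cell `b2b-bsdres`, supersingular family prover B = unit `b2b-bsdres-additive-p3`, GEN 26; CLASS-CLOSURE class lead N6·O3, X7 joint B)

HONEST FRAMING (run/shared/lean/b2b/bsd-rank1-residual/, verbatim in every file): the goal of the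
cell is to DELETE the COMBINATION-SHAPED residual classes of the Birch–Swinnerton-Dyer formula for
ALL analytic-rank `≤ 1` elliptic curves over `ℚ` — "full BSD formula for every rank `≤ 1` curve in
class `C`" assembled STRICTLY from published theorems — so that the rank-`≤ 1` remainder becomes
exactly the CONSTRUCTION-SHAPED classes, which are TYPED (missing-input `Prop`s), NOT attempted.
This is not "finishing BSD". Classes X7 / X8 stay CONSTRUCTION-SHAPED; these are per-pair record
SHAPES (certificate consumers); the second-descent outputs that instantiate them are
INSTRUMENTATION (class-closure E4) / EVIDENCE under census-lead's tier label; no lane verdict is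
changed; no named fact is added; nothing is booked by this unit. THEOREMS ONLY (no definition, no
named fact, no `sorry`).

## What this file does

cc-eng-4 GEN 6's literal-model `EMPTY` reading `bsdp_of_ainvs_of_irr_of_card_selmer_of_casselsTate_of_not_divisible`
(`EmptyRecordsThree01.lean` §3; underlying `bsdp_of_irr_of_card_selmer_of_casselsTate_of_not_divisible`
p288200: GZK + the Cassels–Tate pairing + `r_an ≤ 1` + `E[p]` irreducible + `#Sel^(p)(E/ℚ) = p^(r_an+2)` +
ONE `p`-torsion class of `Ш` that is NOT a `p`-th multiple in `Ш` + `ord_p #Ш_an = 2` ⟹ `BSD(E,p)` —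
NO upper-half theorem: the certificate pins `#Ш[p^∞] = p²` exactly) takes `hirr : Irr W p`.  The
rank-one `#Ш_an = 9·u` targets of this class lead (additive-p3 GEN 19 `R1-SHA2`: O3 22 + O4@3 35 rows,
cc-eng-4's kernel certificates `R1Sha2TargetsKernelCertificatesP00–P07`) carry a kernel certificate
of SURJECTIVITY `surj3_s<label> : Surj W 3`, not of irreducibility; this file supplies the two
wrappers that take `Surj W 3` (irreducible by `hasIrreducibleModPGaloisRep_of_hasSurjectiveModNGaloisRep`,
Serre 1972 §4): §1 any analytic rank `≤ 1` (`#Sel^(3) = 3^(r_an+2)`), §2 the rank-ONE form with the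
displayed count `#Sel^(3)(E/ℚ) = 27`.  A record is then ONE `subst; exact` with binders: named facts
`hGZK`, `hCT` (PUBLISHED); `hr` (`r_an = 1`), `h27` (the first descent: `dim Sel₃ = 3`), the `EMPTY`
certificate `h3c hndiv` (one `Sel₃` class, `3`-torsion in `Ш`, with `Sel^(3)(C) = ∅` for its cubic
`C` ⟺ `[C] ∉ 3·Sel^(9)`, Creutz 2014 §1/§7), `hq`/`hv` (`ord₃ #Ш_an = 2`) — NO Kim 2025 (PRE) binder, NO
upper-half theorem.  Per pair; classes unchanged; nothing booked.  References: B. Creutz, Math. Comp.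
83 (2014) §1, §7 [Creutz2014]; J. H. Silverman, *AEC* X.4 [SilvermanAEC2009]; R. L. Miller, LMS JCM 14
(2011) §1 [Miller2011LMS]; J.-P. Serre, Invent. Math. 15 (1972) §4 [Serre1972].
-/

set_option autoImplicit false

noncomputable section

open scoped Classical

open WeierstrassCurve Literature.NumberTheory.EllipticCurves
  Literature.NumberTheory.EllipticCurves.ModularForms
  Literature.NumberTheory.EllipticCurves.Rank1Residual
  Literature.NumberTheory.EllipticCurves.Rank1Residual.Typed
  Literature.NumberTheory.EllipticCurves.Rank1Residual.X11RankOneCertificates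
  Summit.BirchSwinnertonDyer.Rank1Residual.X11b

namespace Summit.BirchSwinnertonDyer.Rank1Residual.SecondDescent

/-! ### §1. Any analytic rank `≤ 1`, surjective `ρ̄_{E,3}` -/

/-- **B-1 `EMPTY` reading for a literal model at `p = 3`, analytic rank `≤ 1`, SURJECTIVE `ρ̄_{E,3}`**:
GZK + Cassels–Tate + `r_an ≤ 1` + `ρ̄_{E,3}` onto (hence `E[3]` irreducible) + `#Sel^(3)(E/ℚ) = 3^(r_an+2)`
+ ONE `3`-torsion class of `Ш` that is not a third multiple + `ord₃ #Ш_an = 2` ⟹ `BSD(E,3)` (=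
`bsdp_of_ainvs_of_irr_of_card_selmer_of_casselsTate_of_not_divisible` with `hirr` from `Surj`). Class-free;
per pair; nothing booked. [cite: Creutz2014, §1 and §7] [cite: SilvermanAEC2009, Thm. X.4.2(a) and Thm. X.4.14]
[cite: Serre1972, §4] [cite: Miller2011LMS, §1 and Def. 1.1] -/
theorem bsdp_three_of_ainvs_of_surj_of_card_selmer_of_casselsTate_of_not_divisible
    (hGZK : rank_eq_analyticRank_of_analyticRank_le_one)
    (hCT : exists_casselsTate_pairing (K := ℚ))
    (a1 a2 a3 a4 a6 : ℤ) (hΔ : discOf [a1, a2, a3, a4, a6] ≠ 0)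
    (hs : Surj (⟨a1, a2, a3, a4, a6⟩ : WeierstrassCurve ℚ) 3)
    (hr : (⟨a1, a2, a3, a4, a6⟩ : WeierstrassCurve ℚ).analyticRank ≤ 1)
    (hSel : Nat.card ((⟨a1, a2, a3, a4, a6⟩ : WeierstrassCurve ℚ).selmerGroup (3 : ℤ)) =
      3 ^ ((⟨a1, a2, a3, a4, a6⟩ : WeierstrassCurve ℚ).analyticRank + 2))
    {c : (⟨a1, a2, a3, a4, a6⟩ : WeierstrassCurve ℚ).sha} (h3c : 3 • c = 0)
    (hndiv : ∀ d : (⟨a1, a2, a3, a4, a6⟩ : WeierstrassCurve ℚ).sha, 3 • d ≠ c)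
    {q : ℚ} (hq : shaAn (⟨a1, a2, a3, a4, a6⟩ : WeierstrassCurve ℚ) = (q : ℂ))
    (hv : padicValRat 3 q = 2) : BSDp (⟨a1, a2, a3, a4, a6⟩ : WeierstrassCurve ℚ) 3 := by
  haveI := isElliptic_of_discOf_ne_zero a1 a2 a3 a4 a6 hΔ
  haveI : Fact (Nat.Prime 3) := ⟨Nat.prime_three⟩
  exact bsdp_of_ainvs_of_irr_of_card_selmer_of_casselsTate_of_not_divisible hGZK hCT a1 a2 a3 a4 a6
    hΔ 3 hr (hasIrreducibleModPGaloisRep_of_hasSurjectiveModNGaloisRep _ 3 hs)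
    (by exact_mod_cast hSel) (by exact_mod_cast h3c) (by exact_mod_cast hndiv) hq hv

/-! ### §2. Rank ONE: the displayed count is `#Sel^(3)(E/ℚ) = 27` -/

/-- **B-1 `EMPTY` reading for a literal model at `p = 3`, analytic rank ONE, SURJECTIVE `ρ̄_{E,3}`, with
the displayed first-descent count `#Sel^(3)(E/ℚ) = 27`** (`= 3^{r_an} · #E(ℚ)[3] · #Ш[3]` with
`r_an = 1`, `E(ℚ)[3] = 0`, `Ш[3] ≅ (ℤ/3)²`): + ONE `3`-torsion class of `Ш` not a third multiple +
`ord₃ #Ш_an = 2` ⟹ `BSD(E,3)`. The record shape of the rank-one `#Ш_an = 9·u` rows of class-closure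
O3 (X8 r1) / O4@3 (X7 r1). Class-free; per pair; nothing booked. [cite: Creutz2014, §1 and §7]
[cite: SilvermanAEC2009, Thm. X.4.2(a) and Thm. X.4.14] [cite: Serre1972, §4] [cite: Miller2011LMS, §1 and Def. 1.1] -/
theorem bsdp_three_rankOne_of_ainvs_of_surj_of_card_selmerThree_eq_27_of_casselsTate_of_not_divisible
    (hGZK : rank_eq_analyticRank_of_analyticRank_le_one)
    (hCT : exists_casselsTate_pairing (K := ℚ))
    (a1 a2 a3 a4 a6 : ℤ) (hΔ : discOf [a1, a2, a3, a4, a6] ≠ 0)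
    (hs : Surj (⟨a1, a2, a3, a4, a6⟩ : WeierstrassCurve ℚ) 3)
    (hr : (⟨a1, a2, a3, a4, a6⟩ : WeierstrassCurve ℚ).analyticRank = 1)
    (h27 : Nat.card ((⟨a1, a2, a3, a4, a6⟩ : WeierstrassCurve ℚ).selmerGroup (3 : ℤ)) = 27)
    {c : (⟨a1, a2, a3, a4, a6⟩ : WeierstrassCurve ℚ).sha} (h3c : 3 • c = 0)
    (hndiv : ∀ d : (⟨a1, a2, a3, a4, a6⟩ : WeierstrassCurve ℚ).sha, 3 • d ≠ c)
    {q : ℚ} (hq : shaAn (⟨a1, a2, a3, a4, a6⟩ : WeierstrassCurve ℚ) = (q : ℂ))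
    (hv : padicValRat 3 q = 2) : BSDp (⟨a1, a2, a3, a4, a6⟩ : WeierstrassCurve ℚ) 3 :=
  bsdp_three_of_ainvs_of_surj_of_card_selmer_of_casselsTate_of_not_divisible hGZK hCT a1 a2 a3 a4 a6
    hΔ hs (by rw [hr]) (by rw [hr, h27]; norm_num) h3c hndiv hq hv

end Summit.BirchSwinnertonDyer.Rank1Residual.SecondDescent

end
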